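import Literature.AnabelianGeometry.EtaleTheta.Discharge.Sec1ZNClauseStructure
import Literature.FieldTheory.KummerAbelianExponentContainment
import Literature.NumberTheory.GaloisRepresentations.AbsGaloisStronglyComplete
import Literature.NumberTheory.GaloisRepresentations.LocalFieldPadicProofs
import Mathlib.FieldTheory.Galois.Profinite
import HarnessLib

/-!
# [EtTh] §1 p. 14 «[by the definition of `J_N`] all splittings determine the same splitting over `G_{J_N}`» —
# the UNIQUENESS HALF of the origin clause `GtpZNFromSplitting` as a THEOREM AT THE ROOT (print generality)

Mochizuki, *The étale theta function and its Frobenioid-theoretic manifestations*, Publ. RIMS **45** (2009) [EtTh],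
§1, PRIMS PDF p. 14 l. 25–46 (kurims p. 13): «we have an exact sequence
`1 → Δ_Θ ⊗ ℤ/Nℤ (≅ ℤ/Nℤ(1)) → (Π^tp_{Y_N})^Θ/N·(Δ^tp_Y)^Θ → G_{K_N} → 1` … Since any two splittings of this exact
sequence differ by a cohomology class `∈ H¹(G_{K_N}, ℤ/Nℤ(1))`, it follows [by the definition of `J_N`] that all splittings
of this exact sequence determine the same splitting over `G_{J_N}`» [cite: MochizukiEtTh2009, §1 p.14].
abc-iut cell, layer L2, seat abc-iut-w5-d062 (gen 5); row «ZN-UNIQUENESS-AT-THE-ROOT» (abc-iut-L2-lead; §1 root owner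
abc-iut-L2-t1: GO 21:45Z).  PROOF-ONLY: no definition, no `Prop`-valued definition, no new named fact, no `sorry`.

WHAT IS PROVED.  For an ARBITRARY theta setting `D : ThetaSetting p` (no model) and a level `N`, write
`P := N·(Δ^tp_Y)^Θ` (`D.thetaPowersY N`).  Granted
* `hsc` — strong completeness of `G_{ℚ_p}` («every finite-index subgroup is open»; Nikolov–Segal at `G_{ℚ_p}`, unconditional
  Summits-side: `Summit.ABC.IUTFork.stronglyComplete_GQp`),
* `hcen` — «`Π^tp_{Y_N}` centralises `(Δ^tp_{Y_N})^Θ` modulo `N·(Δ^tp_Y)^Θ`»: for `g ∈ Π^tp_{Y_N}` and `y ∈ Δ^tp_{Y_N}`,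
  `θ(g)θ(y)θ(g)⁻¹θ(y)⁻¹ ∈ P` — the printed structure of the extension above (its kernel `Δ_Θ ⊗ ℤ/Nℤ ≅ ℤ/Nℤ(1)` is abelian,
  central in `(Δ^tp_X)^Θ`, and `G_{K_N} ∋`-fixes `ζ_N`, so the conjugation action of `(Π^tp_{Y_N})^Θ` on it is trivial),
* `hex` — the ∃-form of the origin clause: SOME lifted splitting over `G_{K_N}` cuts out `Π^tp_{Z_N}` (this is how print
  DEFINES `Z_N`; witnessed at every model of the tree: abc-iut-L2-d1's `exists_thetaSplitting_gtpZN_iff_modelχ/χq`,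
  abc-iut-L2-t1's `…_modelκ'`),
ANY TWO lifted splittings agree on `G_{J_N}` modulo `P` (`splittings_agree_of_exists_of_stronglyComplete`), hence the ∀-form
`D.GtpZNFromSplitting N` holds (`gtpZNFromSplitting_of_exists_of_stronglyComplete`, via abc-iut-L2-t1's
`gtpZNFromSplitting_of_exists_of_agree`).  The three model files «`GtpZNFromSplitting` for ALL splittings» (χ: this seat's
p458978; χq: abc-iut-L2-t1's p463822; κ′: p467332) are thereby made MODEL-FREE.

MECHANISM (= print's sentence).  For lifts `g_σ, g'_σ ∈ Π^tp_{Y_N}` of `s(σ), s'(σ)` the difference `θ(g_σ g'_σ⁻¹)` lies in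
`B̄ := θ(Δ^tp_{Y_N})·P/P ≤ (Π^tp_X)^Θ/P`; by `hex` (and `s₀(1) ∈ P`) the clause gives `Δ^tp_{Z_N} = Δ^tp_{Y_N} ∩ θ⁻¹(P)`, so
`|B̄| ∣ (Δ^tp_{Y_N} : Δ^tp_{Z_N}) = N` (root axiom `relIndex_deltaZN`) — `B̄` is FINITE, of exponent `N` (definition of `P`)
and commutative (`hcen`); `hcen` makes `σ ↦ θ(g_σ g'_σ⁻¹)·P` a HOMOMORPHISM `G_{K_N} → B̄` (print's class in
`H¹(G_{K_N}, ℤ/Nℤ(1)) = Hom`); its kernel has finite index, hence is OPEN (`hsc`), hence contains `G_{J_N}` by Kummer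
containment (this seat's `Literature.FieldTheory.KummerContainment.apply_eq_one_of_mem_fixingSubgroup_adjoin_roots`,
p457921: `K_N ∋ μ_N` and `J_N = K_N(K_N^{1/N})`).

HONEST FRAMING: [EtTh] is refereed; nothing asserted beyond the tree's proofs; `hcen`/`hex` are DISPLAYED printed clauses of
the genuine data (not root axioms), `hsc` a classical theorem carried by name; nothing here bears on [IUTchIII] Cor. 3.12;
typed ≠ proved.
-/

noncomputable section

open scoped IsMulCommutative

namespace Literature.AnabelianGeometry.EtaleTheta

open Literature.AnabelianGeometry.SemiGraphs Literature.AnabelianGeometry.AbsoluteAnabelian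
open Literature.NumberTheory.GaloisRepresentations

namespace ThetaSetting

variable {p : ℕ} [Fact p.Prime] (D : ThetaSetting p) (N : ℕ+)

/-! ### `N·(Δ^tp_Y)^Θ` is normal; first consequences of a lifted splitting -/

/-- In a quotient `G/P`, two classes commute as soon as the commutator lies in `P` (plain group theory). [folklore] -/
private theorem quot_mk'_mul_comm_of_mem {G : Type*} [Group G] (P : Subgroup G) [P.Normal] {a b : G}
    (h : a * b * a⁻¹ * b⁻¹ ∈ P) :
    QuotientGroup.mk' P a * QuotientGroup.mk' P b = QuotientGroup.mk' P b * QuotientGroup.mk' P a := by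
  rw [← map_mul, ← map_mul, QuotientGroup.mk'_apply, QuotientGroup.mk'_apply, QuotientGroup.eq_iff_div_mem,
    div_eq_mul_inv, mul_inv_rev, ← mul_assoc]
  exact h

/-- `(Δ^tp_Y)^Θ` is normal in `(Π^tp_X)^Θ` (image of a normal subgroup under the surjection `θ`).
[cite: MochizukiEtTh2009, §1 p.12] -/
theorem dtpYTheta_normal : D.DtpYTheta.Normal := by
  haveI := D.dtpY_normal
  exact Subgroup.Normal.map inferInstance D.toTheta D.toTheta_surjective

/-- **`N·(Δ^tp_Y)^Θ` is normal in `(Π^tp_X)^Θ`** (generated by the conjugation-stable set of `N`-th powers of the normal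
subgroup `(Δ^tp_Y)^Θ`). [cite: MochizukiEtTh2009, §1 p.14] -/
theorem thetaPowersY_normal : (D.thetaPowersY N).Normal := by
  haveI := D.dtpYTheta_normal
  refine ⟨fun x hx g => ?_⟩
  have hle : (D.thetaPowersY N).map (MulAut.conj g).toMonoidHom ≤ D.thetaPowersY N := by
    rw [thetaPowersY, MonoidHom.map_closure]
    refine Subgroup.closure_mono ?_
    rintro _ ⟨_, ⟨y, hy, rfl⟩, rfl⟩
    refine ⟨MulAut.conj g y, Subgroup.Normal.conj_mem inferInstance y hy g, ?_⟩
    change (MulAut.conj g y) ^ (N : ℕ) = (MulAut.conj g).toMonoidHom (y ^ (N : ℕ))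
    rw [MulEquiv.coe_toMonoidHom, map_pow]
  exact hle ⟨x, hx, rfl⟩

variable {D N}

/-- A lifted splitting takes the value `s(1) ∈ N·(Δ^tp_Y)^Θ` (it is multiplicative modulo `N·(Δ^tp_Y)^Θ`).
[cite: MochizukiEtTh2009, §1 p.14] -/
theorem IsThetaSplittingAt.apply_one_mem {s : ↥(D.GKN N) → D.GtpTheta} (hs : D.IsThetaSplittingAt N s) :
    s 1 ∈ D.thetaPowersY N := by
  have h := hs.map_mul_mem 1 1
  rw [mul_one, mul_inv_rev, ← mul_assoc, mul_inv_cancel, one_mul] at h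
  exact (Subgroup.inv_mem_iff _).mp h

/-- For `y ∈ Δ^tp_{Y_N}`: `θ(y)^N ∈ N·(Δ^tp_Y)^Θ` (as `Δ^tp_{Y_N} ≤ Δ^tp_Y`). [cite: MochizukiEtTh2009, §1 p.14] -/
theorem toTheta_pow_mem_thetaPowersY {y : D.PiTemp} (hy : y ∈ D.DtpYN N) :
    D.toTheta y ^ (N : ℕ) ∈ D.thetaPowersY N := by
  have hyY : y ∈ D.DtpY :=
    Subgroup.mem_inf.mpr ⟨D.GtpYN_le N (Subgroup.mem_inf.mp hy).1, (Subgroup.mem_inf.mp hy).2⟩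
  exact Subgroup.subset_closure ⟨D.toTheta y, ⟨y, hyY, rfl⟩, rfl⟩

/-- **The ∃-form pins `Δ^tp_{Z_N}` inside `Δ^tp_{Y_N}` by `θ⁻¹(N·(Δ^tp_Y)^Θ)`**: if some lifted splitting `s₀` cuts out
`Π^tp_{Z_N}`, then for `y ∈ Δ^tp_{Y_N}`, `y ∈ Π^tp_{Z_N} ↔ θ(y) ∈ N·(Δ^tp_Y)^Θ` (`aug y = 1 ∈ G_{J_N}`, `s₀(1) ∈ P`).
[cite: MochizukiEtTh2009, §1 p.14] -/
theorem mem_GtpZN_iff_toTheta_mem_of_clause {s₀ : ↥(D.GKN N) → D.GtpTheta} (hs₀ : D.IsThetaSplittingAt N s₀)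
    (hcl : ∀ g : D.PiTemp, g ∈ D.GtpZN N ↔ g ∈ D.GtpYN N ∧ ∃ h : D.aug g ∈ D.GJN N,
      D.toTheta g * (s₀ ⟨D.aug g, D.GJN_le_GKN N h⟩)⁻¹ ∈ D.thetaPowersY N)
    {y : D.PiTemp} (hy : y ∈ D.DtpYN N) : y ∈ D.GtpZN N ↔ D.toTheta y ∈ D.thetaPowersY N := by
  obtain ⟨hyY, hyΔ⟩ := Subgroup.mem_inf.mp hy
  have hy1 : D.aug y = 1 := hyΔ
  have hJ : D.aug y ∈ D.GJN N := by rw [hy1]; exact Subgroup.one_mem _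
  have key : ∀ h : D.aug y ∈ D.GJN N, s₀ ⟨D.aug y, D.GJN_le_GKN N h⟩ = s₀ 1 := fun h =>
    congrArg s₀ (Subtype.ext hy1)
  rw [hcl y]
  constructor
  · rintro ⟨-, h, hm⟩
    rw [key h] at hm
    have := Subgroup.mul_mem _ hm hs₀.apply_one_mem
    rwa [inv_mul_cancel_right] at this
  · intro hm
    refine ⟨hyY, hJ, ?_⟩
    rw [key hJ]
    exact Subgroup.mul_mem _ hm (Subgroup.inv_mem _ hs₀.apply_one_mem)

/-! ### The finite abelian exponent-`N` group `θ(Δ^tp_{Y_N})·P/P` -/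

section Bbar

variable (D N)

/-- The image of `Δ^tp_{Y_N}` in `(Π^tp_X)^Θ/N·(Δ^tp_Y)^Θ` («`Δ_Θ ⊗ ℤ/Nℤ`», p. 14), as the range of the composite
homomorphism (no new definition is introduced: this is an inline abbreviation inside proofs via `haveI`).
[cite: MochizukiEtTh2009, §1 p.14] -/
theorem range_quot_finite_of_clause {s₀ : ↥(D.GKN N) → D.GtpTheta} (hs₀ : D.IsThetaSplittingAt N s₀)
    (hcl : ∀ g : D.PiTemp, g ∈ D.GtpZN N ↔ g ∈ D.GtpYN N ∧ ∃ h : D.aug g ∈ D.GJN N,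
      D.toTheta g * (s₀ ⟨D.aug g, D.GJN_le_GKN N h⟩)⁻¹ ∈ D.thetaPowersY N) :
    haveI := D.thetaPowersY_normal N
    Finite ↥(((QuotientGroup.mk' (D.thetaPowersY N)).comp (D.toTheta.comp (D.DtpYN N).subtype)).range) := by
  haveI := D.thetaPowersY_normal N
  set φ := (QuotientGroup.mk' (D.thetaPowersY N)).comp (D.toTheta.comp (D.DtpYN N).subtype) with hφ
  -- `Ker φ ⊇ Δ^tp_{Z_N}` (read inside `Δ^tp_{Y_N}`), which has index `N`
  have hle : (D.DtpZN N).subgroupOf (D.DtpYN N) ≤ φ.ker := by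
    intro y hy
    rw [Subgroup.mem_subgroupOf] at hy
    rw [MonoidHom.mem_ker, hφ, MonoidHom.comp_apply, MonoidHom.comp_apply, Subgroup.coe_subtype,
      QuotientGroup.mk'_apply, QuotientGroup.eq_one_iff]
    exact (mem_GtpZN_iff_toTheta_mem_of_clause hs₀ hcl y.2).mp (Subgroup.mem_inf.mp hy).1
  have hidx : ((D.DtpZN N).subgroupOf (D.DtpYN N)).index = N := D.relIndex_deltaZN N
  have hker : φ.ker.index ≠ 0 := by
    intro h0
    have hdvd := Subgroup.index_dvd_of_le hle
    rw [hidx, h0, zero_dvd_iff] at hdvd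
    exact N.ne_zero hdvd
  haveI : φ.ker.FiniteIndex := ⟨hker⟩
  haveI : Finite (↥(D.DtpYN N) ⧸ φ.ker) := Subgroup.finite_quotient_of_finiteIndex
  exact Finite.of_equiv _ (QuotientGroup.quotientKerEquivRange φ).toEquiv

end Bbar

/-! ### «All splittings determine the same splitting over `G_{J_N}`» -/

/-- **[EtTh] §1 p. 14, the uniqueness half AT THE ROOT**: granted strong completeness of `G_{ℚ_p}` (`hsc`), the printed
structure «`Π^tp_{Y_N}` centralises `(Δ^tp_{Y_N})^Θ` modulo `N·(Δ^tp_Y)^Θ`» (`hcen`: the kernel `Δ_Θ ⊗ ℤ/Nℤ ≅ ℤ/Nℤ(1)` of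
`(Π^tp_{Y_N})^Θ/N·(Δ^tp_Y)^Θ ↠ G_{K_N}` is central), and the ∃-form of the origin clause (`hex`: SOME lifted splitting cuts
out `Π^tp_{Z_N}` — print's definition of `Z_N`), ANY TWO lifted splittings over `G_{K_N}` agree on `G_{J_N}` modulo
`N·(Δ^tp_Y)^Θ`: their difference is a homomorphism `G_{K_N} → θ(Δ^tp_{Y_N})·P/P` (finite, abelian, exponent `N`) with open
kernel, killed on `G_{J_N} = Gal(ℚ̄_p/K_N(K_N^{1/N}))` by Kummer containment. [cite: MochizukiEtTh2009, §1 p.14] -/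
theorem splittings_agree_of_exists_of_stronglyComplete
    (hsc : ∀ U : Subgroup (GQp p), U.FiniteIndex → IsOpen (U : Set (GQp p)))
    (hcen : ∀ g ∈ D.GtpYN N, ∀ y ∈ D.DtpYN N,
      D.toTheta g * D.toTheta y * (D.toTheta g)⁻¹ * (D.toTheta y)⁻¹ ∈ D.thetaPowersY N)
    (hex : ∃ s₀ : ↥(D.GKN N) → D.GtpTheta, D.IsThetaSplittingAt N s₀ ∧
      ∀ g : D.PiTemp, g ∈ D.GtpZN N ↔ g ∈ D.GtpYN N ∧ ∃ h : D.aug g ∈ D.GJN N,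
        D.toTheta g * (s₀ ⟨D.aug g, D.GJN_le_GKN N h⟩)⁻¹ ∈ D.thetaPowersY N)
    {s s' : ↥(D.GKN N) → D.GtpTheta} (hs : D.IsThetaSplittingAt N s) (hs' : D.IsThetaSplittingAt N s')
    {σ : GQp p} (hσ : σ ∈ D.GJN N) :
    s ⟨σ, D.GJN_le_GKN N hσ⟩ * (s' ⟨σ, D.GJN_le_GKN N hσ⟩)⁻¹ ∈ D.thetaPowersY N := by
  haveI := D.thetaPowersY_normal N
  haveI : IsGalois ℚ_[p] (PadicAlgCl p) := {}
  obtain ⟨s₀, hs₀, hcl⟩ := hex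
  -- notation: the quotient by `P`, the image `B̄` of `Δ^tp_{Y_N}` in it
  set P := D.thetaPowersY N with hP
  let π : D.GtpTheta →* D.GtpTheta ⧸ P := QuotientGroup.mk' P
  let φ : ↥(D.DtpYN N) →* D.GtpTheta ⧸ P := π.comp (D.toTheta.comp (D.DtpYN N).subtype)
  have hφ : ∀ y : ↥(D.DtpYN N), φ y = π (D.toTheta (y : D.PiTemp)) := fun y => rfl
  let B : Subgroup (D.GtpTheta ⧸ P) := φ.range
  haveI hBfin : Finite ↥B := D.range_quot_finite_of_clause N hs₀ hcl
  -- `B̄` is commutative (from `hcen` on `Δ^tp_{Y_N} ≤ Π^tp_{Y_N}`) …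
  haveI : IsMulCommutative ↥B := by
    refine ⟨⟨fun a b => ?_⟩⟩
    obtain ⟨⟨x, hx⟩, hxa⟩ := a.2
    obtain ⟨⟨y, hy⟩, hyb⟩ := b.2
    apply Subtype.ext
    rw [Subgroup.coe_mul, Subgroup.coe_mul, ← hxa, ← hyb, hφ, hφ]
    exact quot_mk'_mul_comm_of_mem P (hcen x (Subgroup.mem_inf.mp hx).1 y hy)
  -- … and killed by `N`
  have hBN : ∀ b : ↥B, b ^ (N : ℕ) = 1 := by
    intro b
    obtain ⟨⟨y, hy⟩, hyb⟩ := b.2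
    apply Subtype.ext
    rw [Subgroup.coe_pow, Subgroup.coe_one, ← hyb, hφ]
    change π (D.toTheta y) ^ (N : ℕ) = 1
    rw [← map_pow, QuotientGroup.mk'_apply, QuotientGroup.eq_one_iff]
    exact toTheta_pow_mem_thetaPowersY hy
  -- lifts of the two splittings
  choose g hgY hgaug hgθ using hs.exists_lift
  choose g' hg'Y hg'aug hg'θ using hs'.exists_lift
  -- the difference of lifts lies in `Δ^tp_{Y_N}`
  have hδ : ∀ τ : ↥(D.GKN N), g τ * (g' τ)⁻¹ ∈ D.DtpYN N := by
    intro τ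
    refine Subgroup.mem_inf.mpr ⟨Subgroup.mul_mem _ (hgY τ) (Subgroup.inv_mem _ (hg'Y τ)), ?_⟩
    change D.aug (g τ * (g' τ)⁻¹) = 1
    rw [map_mul, map_inv, hgaug, hg'aug, mul_inv_cancel]
  -- the value `π(s τ · s' τ⁻¹) = φ(g τ · g' τ⁻¹) ∈ B̄`
  have hval : ∀ τ : ↥(D.GKN N), π (s τ * (s' τ)⁻¹) = φ ⟨g τ * (g' τ)⁻¹, hδ τ⟩ := by
    intro τ
    rw [hφ]
    change π (s τ * (s' τ)⁻¹) = π (D.toTheta (g τ * (g' τ)⁻¹))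
    rw [map_mul D.toTheta, map_inv D.toTheta, hgθ, hg'θ]
  have hmemB : ∀ τ : ↥(D.GKN N), π (s τ * (s' τ)⁻¹) ∈ B := fun τ => by
    rw [hval]; exact ⟨_, rfl⟩
  -- multiplicativity of `π ∘ s`, `π ∘ s'`
  have hmul : ∀ τ τ' : ↥(D.GKN N), π (s (τ * τ')) = π (s τ) * π (s τ') := fun τ τ' => by
    rw [← map_mul, QuotientGroup.mk'_apply, QuotientGroup.mk'_apply, QuotientGroup.eq_iff_div_mem, div_eq_mul_inv]
    exact hs.map_mul_mem τ τ'
  have hmul' : ∀ τ τ' : ↥(D.GKN N), π (s' (τ * τ')) = π (s' τ) * π (s' τ') := fun τ τ' => by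
    rw [← map_mul, QuotientGroup.mk'_apply, QuotientGroup.mk'_apply, QuotientGroup.eq_iff_div_mem, div_eq_mul_inv]
    exact hs'.map_mul_mem τ τ'
  -- `π(s' τ)` commutes with the difference values (`hcen` with `g' τ ∈ Π^tp_{Y_N}`)
  have hcomm : ∀ τ τ' : ↥(D.GKN N),
      π (s' τ) * π (s τ' * (s' τ')⁻¹) = π (s τ' * (s' τ')⁻¹) * π (s' τ) := by
    intro τ τ'
    rw [hval τ', hφ, ← hg'θ τ]
    exact quot_mk'_mul_comm_of_mem P (hcen (g' τ) (hg'Y τ) _ (hδ τ'))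
  -- the difference `f : G_{K_N} → B̄` is a HOMOMORPHISM
  let f : ↥(D.GKN N) →* ↥B :=
    MonoidHom.mk' (fun τ => ⟨π (s τ * (s' τ)⁻¹), hmemB τ⟩) fun τ τ' => by
      apply Subtype.ext
      change π (s (τ * τ') * (s' (τ * τ'))⁻¹) = π (s τ * (s' τ)⁻¹) * π (s τ' * (s' τ')⁻¹)
      -- `π(s' τ)` commutes with `π(s τ')·π(s' τ')⁻¹`, hence so does `π(s' τ)⁻¹`
      have hc : π (s' τ) * (π (s τ') * (π (s' τ'))⁻¹) = π (s τ') * (π (s' τ'))⁻¹ * π (s' τ) := by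
        have := hcomm τ τ'
        simp only [map_mul π, map_inv π] at this
        exact this
      have key : π (s τ') * (π (s' τ'))⁻¹ * (π (s' τ))⁻¹ = (π (s' τ))⁻¹ * (π (s τ') * (π (s' τ'))⁻¹) :=
        calc _ = (π (s' τ))⁻¹ * (π (s' τ) * (π (s τ') * (π (s' τ'))⁻¹)) * (π (s' τ))⁻¹ := by group
          _ = (π (s' τ))⁻¹ * (π (s τ') * (π (s' τ'))⁻¹ * π (s' τ)) * (π (s' τ))⁻¹ := by rw [hc]
          _ = (π (s' τ))⁻¹ * (π (s τ') * (π (s' τ'))⁻¹) := by group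
      simp only [map_mul π, map_inv π, hmul, hmul']
      calc _ = π (s τ) * (π (s τ') * (π (s' τ'))⁻¹ * (π (s' τ))⁻¹) := by group
        _ = π (s τ) * ((π (s' τ))⁻¹ * (π (s τ') * (π (s' τ'))⁻¹)) := by rw [key]
        _ = _ := by group
  -- its kernel is open: finite index in `G_{K_N}`, which has finite index in `G_{ℚ_p}`
  have hopen : IsOpen ((f.ker.map (D.GKN N).subtype : Subgroup (GQp p)) : Set (GQp p)) := by
    apply hsc
    haveI : Finite (↥(D.GKN N) ⧸ f.ker) := Finite.of_equiv _ (QuotientGroup.quotientKerEquivRange f).toEquiv.symm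
    haveI : f.ker.FiniteIndex := Subgroup.finiteIndex_of_finite_quotient
    haveI : (D.GKN N).FiniteIndex := by
      haveI : DiscreteTopology (GQp p ⧸ D.GKN N) := QuotientGroup.discreteTopology (D.isOpen_GKN N)
      haveI : Finite (GQp p ⧸ D.GKN N) := finite_of_compact_of_discrete
      exact Subgroup.finiteIndex_of_finite_quotient
    refine ⟨?_⟩
    rw [Subgroup.index_map_subtype]
    exact mul_ne_zero Subgroup.FiniteIndex.index_ne_zero Subgroup.FiniteIndex.index_ne_zero
  -- Kummer containment: `K_N ∋ μ_N`, so `f` kills `G_{J_N} = Gal(ℚ̄_p/K_N(K_N^{1/N}))`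
  have hμ : ∀ ζ : PadicAlgCl p, ζ ^ (N : ℕ) = 1 → ζ ∈ fieldKN D.K D.qX N := fun ζ hζ =>
    IntermediateField.subset_adjoin _ _ (Or.inr (Or.inl hζ))
  obtain ⟨h, h1⟩ := Literature.FieldTheory.KummerContainment.apply_eq_one_of_mem_fixingSubgroup_adjoin_roots
    (fieldKN D.K D.qX N) (N : ℕ) hμ hBN f hopen hσ
  have h2 : π (s ⟨σ, h⟩ * (s' ⟨σ, h⟩)⁻¹) = 1 := by
    have := congrArg Subtype.val h1
    exact this
  rw [QuotientGroup.mk'_apply, QuotientGroup.eq_one_iff] at h2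
  exact h2

/-- **The origin clause `GtpZNFromSplitting` (∀-form) AT THE ROOT from its ∃-form**: granted `hsc`, `hcen` and that SOME
lifted splitting cuts out `Π^tp_{Z_N}`, EVERY lifted splitting does («all splittings … determine the same splitting over
`G_{J_N}` … whose kernel we denote by `Π^tp_{Z_N}`», p. 14; abc-iut-L2-t1's `gtpZNFromSplitting_of_exists_of_agree`).
[cite: MochizukiEtTh2009, §1 p.14] -/
theorem gtpZNFromSplitting_of_exists_of_stronglyComplete
    (hsc : ∀ U : Subgroup (GQp p), U.FiniteIndex → IsOpen (U : Set (GQp p)))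
    (hcen : ∀ g ∈ D.GtpYN N, ∀ y ∈ D.DtpYN N,
      D.toTheta g * D.toTheta y * (D.toTheta g)⁻¹ * (D.toTheta y)⁻¹ ∈ D.thetaPowersY N)
    (hex : ∃ s₀ : ↥(D.GKN N) → D.GtpTheta, D.IsThetaSplittingAt N s₀ ∧
      ∀ g : D.PiTemp, g ∈ D.GtpZN N ↔ g ∈ D.GtpYN N ∧ ∃ h : D.aug g ∈ D.GJN N,
        D.toTheta g * (s₀ ⟨D.aug g, D.GJN_le_GKN N h⟩)⁻¹ ∈ D.thetaPowersY N) :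
    D.GtpZNFromSplitting N :=
  gtpZNFromSplitting_of_exists_of_agree D N hex fun _ _ hs hs' _ hσ =>
    splittings_agree_of_exists_of_stronglyComplete hsc hcen hex hs hs' hσ

/-- The same from topological finite generation of `G_{ℚ_p}` (the tree's Nikolov–Segal-at-`G_k`
`isOpen_of_finiteIndex_absoluteGaloisGroup`; unconditional Summits-side). [cite: MochizukiEtTh2009, §1 p.14]
[cite: NikolovSegal2003, Thm 1.1] -/
theorem gtpZNFromSplitting_of_exists_of_tfg
    (hG : IsTopologicallyFinitelyGenerated (Field.absoluteGaloisGroup ℚ_[p]))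
    (hcen : ∀ g ∈ D.GtpYN N, ∀ y ∈ D.DtpYN N,
      D.toTheta g * D.toTheta y * (D.toTheta g)⁻¹ * (D.toTheta y)⁻¹ ∈ D.thetaPowersY N)
    (hex : ∃ s₀ : ↥(D.GKN N) → D.GtpTheta, D.IsThetaSplittingAt N s₀ ∧
      ∀ g : D.PiTemp, g ∈ D.GtpZN N ↔ g ∈ D.GtpYN N ∧ ∃ h : D.aug g ∈ D.GJN N,
        D.toTheta g * (s₀ ⟨D.aug g, D.GJN_le_GKN N h⟩)⁻¹ ∈ D.thetaPowersY N) :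
    D.GtpZNFromSplitting N := by
  refine D.gtpZNFromSplitting_of_exists_of_stronglyComplete (fun U hU => ?_) hcen hex
  haveI : IsNonarchimedeanLocalField ℚ_[p] := Padic.isNonarchimedeanLocalField_holds p
  exact @isOpen_of_finiteIndex_absoluteGaloisGroup ℚ_[p] _ _ _ _ _ hG U ⟨hU.index_ne_zero⟩

/-- **Equivalence at the root**: under `hsc` and `hcen`, the ∀-form `GtpZNFromSplitting D N` together with the existence
of a lifted splitting is EQUIVALENT to the ∃-form alone — the uniqueness conjunct of abc-iut-L2-t1's
`gtpZNFromSplitting_and_exists_iff` is a THEOREM. [cite: MochizukiEtTh2009, §1 p.14] -/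
theorem gtpZNFromSplitting_and_exists_iff_exists_of_stronglyComplete
    (hsc : ∀ U : Subgroup (GQp p), U.FiniteIndex → IsOpen (U : Set (GQp p)))
    (hcen : ∀ g ∈ D.GtpYN N, ∀ y ∈ D.DtpYN N,
      D.toTheta g * D.toTheta y * (D.toTheta g)⁻¹ * (D.toTheta y)⁻¹ ∈ D.thetaPowersY N) :
    (D.GtpZNFromSplitting N ∧ ∃ s : ↥(D.GKN N) → D.GtpTheta, D.IsThetaSplittingAt N s) ↔
      ∃ s₀ : ↥(D.GKN N) → D.GtpTheta, D.IsThetaSplittingAt N s₀ ∧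
        ∀ g : D.PiTemp, g ∈ D.GtpZN N ↔ g ∈ D.GtpYN N ∧ ∃ h : D.aug g ∈ D.GJN N,
          D.toTheta g * (s₀ ⟨D.aug g, D.GJN_le_GKN N h⟩)⁻¹ ∈ D.thetaPowersY N := by
  constructor
  · rintro ⟨hz, s, hs⟩
    exact ⟨s, hs, hz s hs⟩
  · rintro ⟨s₀, hs₀, hcl⟩
    exact ⟨D.gtpZNFromSplitting_of_exists_of_stronglyComplete hsc hcen ⟨s₀, hs₀, hcl⟩, s₀, hs₀⟩

end ThetaSetting

end Literature.AnabelianGeometry.EtaleTheta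

end
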